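import Literature.AlgebraicGeometry.HodgeTheory.LeviForm
import Mathlib.Analysis.Calculus.FDeriv.Symmetric
import Mathlib.Analysis.Calculus.FDeriv.CompCLM
import HarnessLib

/-!
# The `J`-averaged Hessian numerator is invariant under holomorphic maps (Voisin II, Prop. 1.19 on a
# submanifold: the calculus of `leviNum (φ ∘ A)`)

Family `hodge`, layer `Literature/AlgebraicGeometry/HodgeTheory`.  A brick of the Morse-theoretic
(Andreotti–Frankel) input still missing for the named fact `BFNP2009_vanishingCohomology_nontrivial`
(Brosnan–Fang–Nie–Pearlstein 2009, Prop. 43): the reduction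
`BFNP2009_vanishingCohomology_nontrivial.of_andreottiFrankel_of_eulerChar`
(`VanishingCohomologyNontrivialProofs`) needs `H_j((X ∖ Y)(ℂ); ℂ) = 0`, `j > dim X`, for the
complement of a hypersurface section of a smooth projective `X ↪ ℙᴺ`.  The tree proves this for
`X = ℙᴺ` (`HypersurfaceComplementMorse.isZero_singularHomology_hypersurfaceComplement`: Morse theory
for `g_a = N_a/|F|²` on `U_F = ℂℙᴺ ∖ V(F)`, with the index bound of C. Voisin, *Hodge Theory and
Complex Algebraic Geometry II* (2003), Prop. 1.19, obtained in `LeviForm.lean` /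
`HypersurfaceComplementCharts.lean` from the sign of the quantity
`leviNum J φ x u = φ(x)(D²φₓ(u,u) + D²φₓ(Ju,Ju)) - (Dφₓu)² - (Dφₓ(Ju))²`).  For a general `X` the
Morse function is the RESTRICTION `g_a ∘ A` of `g_a` along the holomorphic immersion `A` of `X(ℂ)`
into `ℂℙᴺ` read in charts (`EmbeddedVarietyImmersion.lean`), and Voisin's Prop. 1.19 is stated
precisely for a complex submanifold `X ⊂ ℂᴺ`: the second fundamental form drops out of the
`J`-averaged Hessian.  This file is that piece of calculus, for real normed spaces `E, E'` with
operators `J, J'` ("multiplication by `i`"):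

* `fderiv_comp_eventuallyEq_of_contDiffAt`, `fderiv_fderiv_comp_apply` — the chain rule to second
  order, `D²(φ ∘ A)ₓ(v, w) = D²φ_{A x}(DA v, DA w) + Dφ_{A x}(D²Aₓ(v, w))`;
* `fderiv_fderiv_apply_J_eq`, `fderiv_fderiv_apply_J_J_eq_neg` — if `DA_y(J u) = J'(DA_y u)` for
  `y` near `x` (holomorphy of `A`) and `J'² = -1`, then `D²Aₓ(v, Ju) = J' D²Aₓ(v, u)` and, by the
  symmetry of second derivatives, `D²Aₓ(Ju, Ju) = -D²Aₓ(u, u)` (the second derivative of a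
  holomorphic map is complex bilinear);
* `leviNum_comp_eq` — **`leviNum J (φ ∘ A) x u = leviNum J' φ (A x) (DAₓ u)`**: the terms
  `Dφ(D²A(u,u)) + Dφ(D²A(Ju,Ju))` cancel.  Consequently the positivity / vanishing statements of
  `LeviForm.lean` and `HypersurfaceComplementCharts.lean` (`leviNum N_a > 0` in non-zero directions,
  `leviNum |F|² = 0`) transfer to `N_a ∘ A`, `|F|² ∘ A` along any holomorphic IMMERSION `A`
  (`leviNum_comp_pos`, `leviNum_comp_eq_zero`), which is Voisin's Prop. 1.19 for the submanifold.

Everything here is proved; no definitions, no named facts.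

## References

* [VoisinHodgeII2003] C. Voisin, Hodge Theory and Complex Algebraic Geometry II (CUP 2003), §1.2.1
  Prop. 1.19 and Lemma 1.20 (PDF p. 58): the Hessian of the squared distance on a complex
  submanifold `X ⊂ ℂᴺ` is `⟨u, u⟩ + Re H(u, u)`.
* [Milnor1963] J. Milnor, Morse theory (1963), §7, proof of Thm. 7.2.
-/

noncomputable section

open scoped Topology
open Filter

namespace Literature.AlgebraicGeometry.HodgeTheory

variable {E E' : Type*} [NormedAddCommGroup E] [NormedSpace ℝ E]
  [NormedAddCommGroup E'] [NormedSpace ℝ E']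

/-! ### The chain rule to second order -/

/-- **Chain rule near a point**: for `A` and `φ` of class `C²` (at `x`, resp. `A x`),
`D(φ ∘ A)_y = Dφ_{A y} ∘ DA_y` for all `y` near `x`. [folklore] -/
theorem fderiv_comp_eventuallyEq_of_contDiffAt {A : E → E'} {φ : E' → ℝ} {x : E}
    (hA : ContDiffAt ℝ 2 A x) (hφ : ContDiffAt ℝ 2 φ (A x)) :
    (fun y => fderiv ℝ (fun z => φ (A z)) y) =ᶠ[𝓝 x]
      fun y => (fderiv ℝ φ (A y)).comp (fderiv ℝ A y) := by
  have hA1 : ∀ᶠ y in 𝓝 x, ContDiffAt ℝ 2 A y := hA.eventually (by simp)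
  have hφ1 : ∀ᶠ y in 𝓝 x, ContDiffAt ℝ 2 φ (A y) :=
    hA.continuousAt.eventually (hφ.eventually (by simp))
  filter_upwards [hA1, hφ1] with y hy hy'
  exact fderiv_fun_comp y (hy'.differentiableAt (by simp)) (hy.differentiableAt (by simp))

/-- **Chain rule to second order**: for `A : E → E'` and `φ : E' → ℝ` of class `C²`,
`D²(φ ∘ A)ₓ(v)(w) = D²φ_{A x}(DAₓ v)(DAₓ w) + Dφ_{A x}(D²Aₓ(v)(w))`. [folklore] -/
theorem fderiv_fderiv_comp_apply {A : E → E'} {φ : E' → ℝ} {x : E}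
    (hA : ContDiffAt ℝ 2 A x) (hφ : ContDiffAt ℝ 2 φ (A x)) (v w : E) :
    fderiv ℝ (fun y => fderiv ℝ (fun z => φ (A z)) y) x v w =
      fderiv ℝ (fun z => fderiv ℝ φ z) (A x) (fderiv ℝ A x v) (fderiv ℝ A x w) +
        fderiv ℝ φ (A x) (fderiv ℝ (fun y => fderiv ℝ A y) x v w) := by
  rw [(fderiv_comp_eventuallyEq_of_contDiffAt hA hφ).fderiv_eq]
  have hc : HasFDerivAt (fun y => fderiv ℝ φ (A y))
      ((fderiv ℝ (fun z => fderiv ℝ φ z) (A x)).comp (fderiv ℝ A x)) x :=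
    (differentiableAt_fderiv_of_contDiffAt hφ).hasFDerivAt.comp x
      (hA.differentiableAt (by simp)).hasFDerivAt
  have hd : HasFDerivAt (fun y => fderiv ℝ A y) (fderiv ℝ (fun y => fderiv ℝ A y) x) x :=
    (differentiableAt_fderiv_of_contDiffAt' hA).hasFDerivAt
  rw [(hc.clm_comp hd).fderiv]
  simp only [add_apply, ContinuousLinearMap.comp_apply,
    ContinuousLinearMap.compL_apply, ContinuousLinearMap.flip_apply]
  rw [add_comm]

/-! ### Second derivatives of a holomorphic map: `D²A(Ju, Ju) = -D²A(u, u)` -/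

/-- The derivative of `y ↦ DA_y u₀` (fixed direction `u₀`) in the direction `v` is `D²Aₓ(v)(u₀)`.
[folklore] -/
theorem fderiv_fderiv_apply_const {A : E → E'} {x : E} (hA : ContDiffAt ℝ 2 A x) (u₀ v : E) :
    fderiv ℝ (fun y => fderiv ℝ A y u₀) x v = fderiv ℝ (fun y => fderiv ℝ A y) x v u₀ := by
  rw [fderiv_clm_apply (differentiableAt_fderiv_of_contDiffAt' hA) (differentiableAt_const u₀)]
  simp

/-- **`D²Aₓ(v, J u) = J' D²Aₓ(v, u)`** if `DA_y(J u) = J'(DA_y u)` for all `y` near `x` (differentiate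
the identity in the direction `v`). [folklore] -/
theorem fderiv_fderiv_apply_J_eq (J : E →L[ℝ] E) (J' : E' →L[ℝ] E') {A : E → E'} {x : E}
    (hA : ContDiffAt ℝ 2 A x) (hJ : ∀ᶠ y in 𝓝 x, ∀ u, fderiv ℝ A y (J u) = J' (fderiv ℝ A y u))
    (u v : E) :
    fderiv ℝ (fun y => fderiv ℝ A y) x v (J u) = J' (fderiv ℝ (fun y => fderiv ℝ A y) x v u) := by
  have hev : (fun y => fderiv ℝ A y (J u)) =ᶠ[𝓝 x] fun y => J' (fderiv ℝ A y u) :=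
    hJ.mono fun y hy => hy u
  have h1 : fderiv ℝ (fun y => fderiv ℝ A y (J u)) x v =
      fderiv ℝ (fun y => J' (fderiv ℝ A y u)) x v := by rw [hev.fderiv_eq]
  rw [fderiv_fderiv_apply_const hA] at h1
  rw [h1]
  have h2 : HasFDerivAt (fun y => J' (fderiv ℝ A y u))
      (J'.comp (fderiv ℝ (fun y => fderiv ℝ A y u) x)) x :=
    J'.hasFDerivAt.comp x ((differentiableAt_fderiv_of_contDiffAt' hA).clm_apply
      (differentiableAt_const u)).hasFDerivAt
  rw [h2.fderiv, ContinuousLinearMap.comp_apply, fderiv_fderiv_apply_const hA]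

/-- **`D²Aₓ(Ju, Ju) = -D²Aₓ(u, u)` for a holomorphic `A`**: if `DA_y(J u) = J'(DA_y u)` for `y` near
`x` and `J'² = -1`, then — by the symmetry of second derivatives of `C²` maps — the second derivative
of `A` is `J'`-bilinear, in particular `D²Aₓ(Ju)(Ju) = J'J' D²Aₓ(u)(u) = -D²Aₓ(u)(u)`. [folklore] -/
theorem fderiv_fderiv_apply_J_J_eq_neg (J : E →L[ℝ] E) (J' : E' →L[ℝ] E') {A : E → E'} {x : E}
    (hA : ContDiffAt ℝ 2 A x) (hJ : ∀ᶠ y in 𝓝 x, ∀ u, fderiv ℝ A y (J u) = J' (fderiv ℝ A y u))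
    (hJ' : ∀ v, J' (J' v) = -v) (u : E) :
    fderiv ℝ (fun y => fderiv ℝ A y) x (J u) (J u) = -fderiv ℝ (fun y => fderiv ℝ A y) x u u := by
  have hsymm : IsSymmSndFDerivAt ℝ A x := hA.isSymmSndFDerivAt (by simp)
  rw [fderiv_fderiv_apply_J_eq J J' hA hJ u (J u)]
  rw [show fderiv ℝ (fun y => fderiv ℝ A y) x (J u) u = fderiv ℝ (fun y => fderiv ℝ A y) x u (J u)
    from hsymm.eq (J u) u]
  rw [fderiv_fderiv_apply_J_eq J J' hA hJ u u, hJ']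

/-! ### `leviNum` of a composite with a holomorphic map -/

/-- **The `J`-averaged Hessian numerator is invariant under holomorphic maps** (Voisin II,
Prop. 1.19 on a complex submanifold: the second fundamental form does not contribute).  Let
`A : E → E'` and `φ : E' → ℝ` be `C²` (at `x`, resp. `A x`), with `DA_y(J u) = J'(DA_y u)` for `y`
near `x` and `J'² = -1`.  Then for every `u`,
`leviNum J (φ ∘ A) x u = leviNum J' φ (A x) (DAₓ u)`: indeed
`D²(φ∘A)(u,u) + D²(φ∘A)(Ju,Ju) = D²φ(a,a) + D²φ(J'a,J'a) + Dφ(D²A(u,u) + D²A(Ju,Ju))` with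
`a = DAₓ u` and the last term zero. [cite: VoisinHodgeII2003, §1.2.1 Prop. 1.19 (PDF p. 58)] -/
theorem leviNum_comp_eq (J : E →L[ℝ] E) (J' : E' →L[ℝ] E') {A : E → E'} {φ : E' → ℝ} {x : E}
    (hA : ContDiffAt ℝ 2 A x) (hφ : ContDiffAt ℝ 2 φ (A x))
    (hJ : ∀ᶠ y in 𝓝 x, ∀ u, fderiv ℝ A y (J u) = J' (fderiv ℝ A y u))
    (hJ' : ∀ v, J' (J' v) = -v) (u : E) :
    leviNum J (fun y => φ (A y)) x u = leviNum J' φ (A x) (fderiv ℝ A x u) := by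
  have hJx : ∀ u, fderiv ℝ A x (J u) = J' (fderiv ℝ A x u) := hJ.self_of_nhds
  have h1 : fderiv ℝ (fun z => φ (A z)) x = (fderiv ℝ φ (A x)).comp (fderiv ℝ A x) :=
    (fderiv_comp_eventuallyEq_of_contDiffAt hA hφ).self_of_nhds
  have h2 := fderiv_fderiv_apply_J_J_eq_neg J J' hA hJ hJ' u
  rw [leviNum_def, leviNum_def, fderiv_fderiv_comp_apply hA hφ u u,
    fderiv_fderiv_comp_apply hA hφ (J u) (J u), h2, hJx u, h1]
  simp only [ContinuousLinearMap.comp_apply, map_neg, hJx u]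
  ring

/-- **Positivity transfers along holomorphic immersion directions**: if `leviNum J' φ > 0` at
`(A x, DAₓ u)` then `leviNum J (φ ∘ A) > 0` at `(x, u)`. [cite: VoisinHodgeII2003, §1.2.1 Prop. 1.19 (PDF p. 58)] -/
theorem leviNum_comp_pos (J : E →L[ℝ] E) (J' : E' →L[ℝ] E') {A : E → E'} {φ : E' → ℝ} {x : E}
    (hA : ContDiffAt ℝ 2 A x) (hφ : ContDiffAt ℝ 2 φ (A x))
    (hJ : ∀ᶠ y in 𝓝 x, ∀ u, fderiv ℝ A y (J u) = J' (fderiv ℝ A y u))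
    (hJ' : ∀ v, J' (J' v) = -v) {u : E} (hpos : 0 < leviNum J' φ (A x) (fderiv ℝ A x u)) :
    0 < leviNum J (fun y => φ (A y)) x u := by
  rwa [leviNum_comp_eq J J' hA hφ hJ hJ' u]

/-- **Vanishing transfers**: if `leviNum J' φ = 0` at `(A x, DAₓ u)` then `leviNum J (φ ∘ A) = 0` at
`(x, u)` (e.g. `φ = |F|²`, `F` holomorphic: `log |F ∘ A|²` is pluriharmonic). [cite: VoisinHodgeII2003, §1.2.1 proof of Prop. 1.19 (PDF p. 58)] -/
theorem leviNum_comp_eq_zero (J : E →L[ℝ] E) (J' : E' →L[ℝ] E') {A : E → E'} {φ : E' → ℝ} {x : E}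
    (hA : ContDiffAt ℝ 2 A x) (hφ : ContDiffAt ℝ 2 φ (A x))
    (hJ : ∀ᶠ y in 𝓝 x, ∀ u, fderiv ℝ A y (J u) = J' (fderiv ℝ A y u))
    (hJ' : ∀ v, J' (J' v) = -v) {u : E} (h0 : leviNum J' φ (A x) (fderiv ℝ A x u) = 0) :
    leviNum J (fun y => φ (A y)) x u = 0 := by
  rw [leviNum_comp_eq J J' hA hφ hJ hJ' u, h0]

end Literature.AlgebraicGeometry.HodgeTheory
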